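import Summits.QuantumFields.BalabanUV.Beta.FP.ConstrainedBiLaplacianParseval

/-!
# `BalabanUV.Beta.FP.ConstrainedBiLaplacianFibreOperator` — road «FP» for binder row D1, row **RHOA-4-GH (localisation half)**, the n-UNIFORM
# currency: FILE 4b — THE ALIAS-FIBRE MATRIX `Gfib` OF THE CONSTRAINED INVERSE OF `(Δ^ξ)^s` ACTS WITH AN n-FREE OPERATOR BOUND ON THE STRIP:
# `‖Σ_{kk′} x_k·y_{k′}·Gfib k k′‖ ≤ Kop d s·‖x‖₂·‖y‖₂`

NOT IN PRINT; OUR PROOF ATTEMPT (binder row G-an2-4 ∕ (CONV-C), prover part P3, fibre∕strip lineage).  HONEST DEPENDENCY (cell records,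
verbatim): «continuum YM on T⁴ ⇐ BetaPertH ∧ nine spine estimates (0/9 proved); BetaPertH ⇐ (D1) ∧ (D4) ∧ CAP+tail; G-an2-4 gates asym, D1
and NE2/3/4.»  HONEST FRAMING (cell contract, verbatim): «discharging `BetaPertH` makes Bałaban's UV stability UNCONDITIONAL — a real
constructive-QFT result; it is NOT the continuum limit and NOT the Clay problem.»  ABSOLUTE RULE (cell charter, verbatim): «No internally-minted
statement may enter as a cited fact. Every hypothesis is either kernel-proved in this package or a verbatim quotation of a PUBLISHED theorem with
page reference. The manuscript(s) under audit are NOT citable for their own disputed steps — they are the thing under adjudication;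
programme-internal (2001/route/tribunal) claims are never citable.»  THIS MODULE is [folklore] algebra + Cauchy–Schwarz over FILES 1–3b and 4a of the row; no symbol of [B4] is re-defined, nothing is cited as
a hypothesis, no `def … : Prop`, no `sorry`.

## The mechanism

`Gfib = T1 + T2 + T3` (`Gfib_eq_pieces`): the DIAGONAL `T1 = [k=k′≠0]·ainv_k` (`‖ainv_k‖ ≤ (64∕7)^s`, a bounded multiplication operator — the
entry sum `Σ_k ainv_k` is what diverges like `log n` at `(2,4)`, its OPERATOR norm does not), the `(0,0)` entry `T2 = Spr∕den`, and three RANK-ONE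
pieces `T3 = −(A_0∕den)·lvec ⊗ rvec − den⁻¹·([k=0]u_0) ⊗ rvec − den⁻¹·lvec ⊗ ([k′=0]ũ_0)` with `lvec_k = [k≠0]u_k ainv_k`, `rvec_{k′} = [k′≠0]ũ_{k′}ainv_{k′}`
square-summable UNIFORMLY IN n: `sqNorm lvec, sqNorm rvec ≤ XB² = ((64∕7)^s 24^d)²` (`Σ_k Π_ν(12∕ω_n(k_ν))² ≤ 576^d`, from `Σ_j ω_n(j)⁻² ≤ 4`).

## Contents

* §1 `T1`, `T2`, `lvec`, `rvec`, `T3`, **`Gfib_eq_pieces`**; `sum_inv_succ_sq_le(_two)`, `sum_inv_omega_sq_le`, `sum_prod_sq_le`, `XB`,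
  **`sqNorm_lvec_le`**, **`sqNorm_rvec_le`**, `norm_le_sqrt_sqNorm`; `Kop d s = (64∕7)^s + (132^d(64∕7)^s + (16d)^s·XB² + 2·12^d·XB)∕cB d`;
  `sum_sum_diag`, `sum_sum_single`, `sum_sum_rankOne`, `sum_sum_T3`, `sum_mul_ite_zero`; **`norm_sum_Gfib_le`**.

0∕4 row-D1 binders touched.  NOT RHOA-4-GH, NOT hbook, NOT D1, NOT BetaPertH, NOT continuum, NOT Clay.  Provenance: prover-b2b-balaban-gan24-p3-g21-0
(unit `b2b-balaban-gan24-p3`, gen 21; R-FP-29 ∕ R-FP-33 (b)), 2026-08-21.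
-/

noncomputable section

namespace Summit.QuantumFields.BalabanUV.Beta.FP.ConstrainedBiLaplacianFibreOperator

open Complex Finset ComplexConjugate
open Literature.MathematicalPhysics.QuantumFieldTheory.Balaban1983to89
open Literature.MathematicalPhysics.QuantumFieldTheory.Balaban1983to89.B4Strip
open Literature.MathematicalPhysics.QuantumFieldTheory.Balaban1983to89.B4StripCauchy
open Literature.MathematicalPhysics.QuantumFieldTheory.Balaban1983to89.B5Strip145Analytic
open Literature.MathematicalPhysics.QuantumFieldTheory.Balaban1983to89.B4StripSums
open Summit.QuantumFields.BalabanUV.Beta.FP.ConstrainedBiLaplacianStrip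
open Summit.QuantumFields.BalabanUV.Beta.FP.ConstrainedBiLaplacianFibre
open Summit.QuantumFields.BalabanUV.Beta.FP.ConstrainedBiLaplacianFibreEntries
open Summit.QuantumFields.BalabanUV.Beta.FP.ConstrainedBiLaplacianFibreSides
open Summit.QuantumFields.BalabanUV.Beta.FP.ConstrainedBiLaplacianKernel
open scoped Real
open Summit.QuantumFields.BalabanUV.Beta.FP.ConstrainedBiLaplacianParseval

variable {d : ℕ}

/-! ## §1 The fibre operator bound (diagonal + `(0,0)` + three rank-one pieces) -/

section Fibre

variable (n : ℕ) [NeZero n] (s : ℕ)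

/-- [folklore] The diagonal piece `[k = k′ ≠ 0]·ainv_k`. -/
def T1 (k k' : Fin d → Fin n) (p : Fin d → ℂ) : ℂ :=
  if k = k' ∧ k ≠ (fun _ => (0 : Fin n)) then ainv n s k p else 0

/-- [folklore] The `(0,0)` piece `Spr∕den`. -/
def T2 (k k' : Fin d → Fin n) (p : Fin d → ℂ) : ℂ :=
  if k = (fun _ => (0 : Fin n)) ∧ k' = (fun _ => (0 : Fin n)) then Spr n s p / den n s p else 0

/-- [folklore] The left rank-one vector `[k ≠ 0]·u_k·ainv_k`. -/
def lvec (k : Fin d → Fin n) (p : Fin d → ℂ) : ℂ :=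
  if k = (fun _ => (0 : Fin n)) then 0 else F n (fun _ => 0) k p * ainv n s k p

/-- [folklore] The right rank-one vector `[k′ ≠ 0]·ũ_{k′}·ainv_{k′}`. -/
def rvec (k' : Fin d → Fin n) (p : Fin d → ℂ) : ℂ :=
  if k' = (fun _ => (0 : Fin n)) then 0 else Fc n (fun _ => 0) k' p * ainv n s k' p

/-- [folklore] The three rank-one pieces together: `−(A_0∕den)·lvec_k·rvec_{k′} − (1∕den)·[k=0]u_0·rvec_{k′} − (1∕den)·lvec_k·[k′=0]ũ_0`. -/
def T3 (k k' : Fin d → Fin n) (p : Fin d → ℂ) : ℂ :=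
  -(DeltaXi n 0 p ^ s / den n s p) * lvec n s k p * rvec n s k' p
    - (den n s p)⁻¹ * (if k = (fun _ => (0 : Fin n)) then F n (fun _ => 0) k p else 0) * rvec n s k' p
    - (den n s p)⁻¹ * lvec n s k p * (if k' = (fun _ => (0 : Fin n)) then Fc n (fun _ => 0) k' p else 0)

/-- [folklore] **THE PIECE DECOMPOSITION** `Gfib = T1 + T2 + T3` (four-case check against FILE 2b's definition). -/
theorem Gfib_eq_pieces (k k' : Fin d → Fin n) (p : Fin d → ℂ) :
    Gfib n s k k' p = T1 n s k k' p + T2 n s k k' p + T3 n s k k' p := by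
  unfold Gfib coef side T1 T2 T3 lvec rvec
  by_cases hk : k = fun _ => (0 : Fin n)
  · by_cases hk' : k' = fun _ => (0 : Fin n)
    · subst hk; subst hk'
      simp
    · subst hk
      have hne : ¬((fun _ => (0 : Fin n)) = k') := fun h => hk' h.symm
      simp only [hne, hk', and_false, and_true, if_false, if_true, ne_eq, not_true_eq_false, not_false_eq_true,
        one_mul, zero_mul, mul_zero, sub_zero, zero_add, add_zero, zero_sub]
      ring
  · by_cases hk' : k' = fun _ => (0 : Fin n)
    · subst hk'
      simp only [hk, and_true, and_false, if_false, if_true, ne_eq, not_true_eq_false, not_false_eq_true, mul_one,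
        mul_zero, sub_zero, zero_add, add_zero, neg_mul, zero_sub]
      ring
    · simp only [hk, hk', and_self, if_false, ne_eq, not_false_eq_true, if_true, and_true, mul_zero, zero_mul,
        sub_zero, add_zero, neg_mul]
      by_cases hkk : k = k'
      · simp only [hkk, if_true]
        ring
      · simp only [hkk, if_false, zero_add]
        ring

variable {n s}

/-- [folklore] `Σ_{j<m} 1∕(j+1)² ≤ 2 − 1∕m` for `m ≥ 1` (telescoping `1∕(j+1)² ≤ 1∕j − 1∕(j+1)`). -/
theorem sum_inv_succ_sq_le (m : ℕ) (hm : 1 ≤ m) : ∑ j ∈ Finset.range m, 1 / (((j : ℕ) : ℝ) + 1) ^ 2 ≤ 2 - 1 / (m : ℝ) := by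
  induction m, hm using Nat.le_induction with
  | base => norm_num
  | succ m hm ih =>
    rw [Finset.sum_range_succ]
    have hm1 : (1 : ℝ) ≤ m := by exact_mod_cast hm
    have key : 1 / (((m : ℕ) : ℝ) + 1) ^ 2 ≤ 1 / (m : ℝ) - 1 / (((m + 1 : ℕ) : ℝ)) := by
      push_cast
      rw [div_sub_div _ _ (by positivity) (by positivity), div_le_div_iff₀ (by positivity) (by positivity)]
      nlinarith
    push_cast at key ih ⊢
    linarith

/-- [folklore] `Σ_{j<m} 1∕(j+1)² ≤ 2`. -/
theorem sum_inv_succ_sq_le_two (m : ℕ) : ∑ j ∈ Finset.range m, 1 / (((j : ℕ) : ℝ) + 1) ^ 2 ≤ 2 := by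
  rcases Nat.eq_zero_or_pos m with h | h
  · subst h; norm_num
  · have := sum_inv_succ_sq_le m h
    have : (0 : ℝ) ≤ 1 / (m : ℝ) := by positivity
    linarith

/-- [folklore] `Σ_{j : Fin n} 1∕ω_n(j)² ≤ 4` (`ω = min(j+1, n−j)`; both tails are `Σ 1∕(j+1)² ≤ 2`, `B4StripCauchy.sum_reflect_inv_sq`). -/
theorem sum_inv_omega_sq_le (n : ℕ) [NeZero n] : ∑ j : Fin n, 1 / omega n j ^ 2 ≤ 4 := by
  have hle : ∀ j : Fin n, 1 / omega n j ^ 2 ≤ 1 / (((j : ℕ) : ℝ) + 1) ^ 2 + 1 / ((n : ℝ) - (j : ℕ)) ^ 2 := by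
    intro j
    have hj : ((j : ℕ) : ℝ) + 1 ≤ n := by exact_mod_cast j.isLt
    have h1 : (0 : ℝ) < ((j : ℕ) : ℝ) + 1 := by positivity
    have h2 : (0 : ℝ) < (n : ℝ) - (j : ℕ) := by linarith
    unfold omega
    rcases le_total (((j : ℕ) : ℝ) + 1) ((n : ℝ) - (j : ℕ)) with h | h
    · rw [min_eq_left h]
      have : (0 : ℝ) ≤ 1 / ((n : ℝ) - (j : ℕ)) ^ 2 := by positivity
      linarith
    · rw [min_eq_right h]
      have : (0 : ℝ) ≤ 1 / (((j : ℕ) : ℝ) + 1) ^ 2 := by positivity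
      linarith
  calc ∑ j : Fin n, 1 / omega n j ^ 2 ≤ ∑ j : Fin n, (1 / (((j : ℕ) : ℝ) + 1) ^ 2 + 1 / ((n : ℝ) - (j : ℕ)) ^ 2) :=
        Finset.sum_le_sum fun j _ => hle j
    _ = 2 * ∑ j : Fin n, 1 / (((j : ℕ) : ℝ) + 1) ^ 2 := by rw [Finset.sum_add_distrib, sum_reflect_inv_sq]; ring
    _ ≤ 2 * 2 := by
        refine mul_le_mul_of_nonneg_left ?_ (by norm_num)
        rw [Fin.sum_univ_eq_sum_range (fun j => 1 / (((j : ℕ) : ℝ) + 1) ^ 2) n]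
        exact sum_inv_succ_sq_le_two n
    _ = 4 := by norm_num

/-- [folklore] `Σ_k Π_ν (12∕ω_n(k_ν))² ≤ 576^d`, uniformly in `n`. -/
theorem sum_prod_sq_le (n : ℕ) [NeZero n] : ∑ k : Fin d → Fin n, ∏ ν, (12 / omega n (k ν)) ^ 2 ≤ (576 : ℝ) ^ d := by
  have h := Finset.prod_univ_sum (fun _ : Fin d => (Finset.univ : Finset (Fin n))) (fun _ j => (12 / omega n (j : ℕ)) ^ 2)
  rw [Fintype.piFinset_univ] at h
  rw [← h]
  have hS : ∑ j : Fin n, (12 / omega n (j : ℕ)) ^ 2 ≤ 576 := by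
    have e : ∀ j : Fin n, (12 / omega n (j : ℕ)) ^ 2 = 144 * (1 / omega n j ^ 2) := fun j => by
      have := omega_pos n j j.isLt; field_simp; norm_num
    simp_rw [e]
    rw [← Finset.mul_sum]
    have := sum_inv_omega_sq_le n
    linarith
  have hS0 : 0 ≤ ∑ j : Fin n, (12 / omega n (j : ℕ)) ^ 2 := Finset.sum_nonneg fun j _ => sq_nonneg _
  calc ∏ _ν : Fin d, ∑ j : Fin n, (12 / omega n (j : ℕ)) ^ 2 ≤ ∏ _ν : Fin d, (576 : ℝ) :=
        Finset.prod_le_prod (fun _ _ => hS0) (fun _ _ => hS)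
    _ = 576 ^ d := by simp

/-- [folklore] The `ℓ²` size of the rank-one vectors: `XB d s = (64∕7)^s·24^d`. -/
def XB (d s : ℕ) : ℝ := (64 / 7) ^ s * 24 ^ d

/-- [folklore] `0 ≤ XB`. -/
theorem XB_nonneg (d s : ℕ) : 0 ≤ XB d s := by unfold XB; positivity

/-- [folklore] `sqNorm (lvec ·) ≤ XB²` on the fat region, uniformly in `n`. -/
theorem sqNorm_lvec_le {r : ℝ} (hr : r ≤ 1 / 4) (hdr : (d : ℝ) * r ^ 2 ≤ 1 / 16) {p : Fin d → ℂ} (hp : p ∈ Fat d r) :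
    sqNorm (fun k => lvec n s k p) ≤ XB d s ^ 2 := by
  unfold sqNorm
  have hk : ∀ k : Fin d → Fin n, ‖lvec n s k p‖ ^ 2 ≤ ((64 / 7) ^ s) ^ 2 * ∏ ν, (12 / omega n (k ν)) ^ 2 := by
    intro k
    unfold lvec
    split_ifs with h
    · rw [norm_zero, sq, zero_mul]; positivity
    · rw [norm_mul, mul_pow, Finset.prod_pow]
      have h1 := norm_F_zero_le n hr k hp
      have h2 := norm_ainv_le' n s hr hdr hp k h
      have hP : 0 ≤ ∏ ν, 12 / omega n (k ν) := Finset.prod_nonneg fun ν _ => by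
        have := omega_pos n (k ν) (k ν).isLt; positivity
      calc ‖F n (fun _ => 0) k p‖ ^ 2 * ‖ainv n s k p‖ ^ 2 ≤ (∏ ν, 12 / omega n (k ν)) ^ 2 * ((64 / 7) ^ s) ^ 2 :=
            mul_le_mul (pow_le_pow_left₀ (norm_nonneg _) h1 2) (pow_le_pow_left₀ (norm_nonneg _) h2 2) (sq_nonneg _) (by positivity)
        _ = ((64 / 7) ^ s) ^ 2 * (∏ ν, 12 / omega n (k ν)) ^ 2 := by ring
  calc ∑ k : Fin d → Fin n, ‖lvec n s k p‖ ^ 2 ≤ ∑ k : Fin d → Fin n, ((64 / 7) ^ s) ^ 2 * ∏ ν, (12 / omega n (k ν)) ^ 2 :=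
        Finset.sum_le_sum fun k _ => hk k
    _ = ((64 / 7) ^ s) ^ 2 * ∑ k : Fin d → Fin n, ∏ ν, (12 / omega n (k ν)) ^ 2 := by rw [Finset.mul_sum]
    _ ≤ ((64 / 7) ^ s) ^ 2 * 576 ^ d := mul_le_mul_of_nonneg_left (sum_prod_sq_le n) (by positivity)
    _ = XB d s ^ 2 := by unfold XB; rw [mul_pow, ← pow_mul (24 : ℝ) d 2, mul_comm d 2, pow_mul]; norm_num

/-- [folklore] `sqNorm (rvec ·) ≤ XB²` on the fat region, uniformly in `n`. -/
theorem sqNorm_rvec_le {r : ℝ} (hr : r ≤ 1 / 4) (hdr : (d : ℝ) * r ^ 2 ≤ 1 / 16) {p : Fin d → ℂ} (hp : p ∈ Fat d r) :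
    sqNorm (fun k => rvec n s k p) ≤ XB d s ^ 2 := by
  unfold sqNorm
  have hk : ∀ k : Fin d → Fin n, ‖rvec n s k p‖ ^ 2 ≤ ((64 / 7) ^ s) ^ 2 * ∏ ν, (12 / omega n (k ν)) ^ 2 := by
    intro k
    unfold rvec
    split_ifs with h
    · rw [norm_zero, sq, zero_mul]; positivity
    · rw [norm_mul, mul_pow, Finset.prod_pow]
      have h1 := norm_Fc_zero_le n hr k hp
      have h2 := norm_ainv_le' n s hr hdr hp k h
      have hP : 0 ≤ ∏ ν, 12 / omega n (k ν) := Finset.prod_nonneg fun ν _ => by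
        have := omega_pos n (k ν) (k ν).isLt; positivity
      calc ‖Fc n (fun _ => 0) k p‖ ^ 2 * ‖ainv n s k p‖ ^ 2 ≤ (∏ ν, 12 / omega n (k ν)) ^ 2 * ((64 / 7) ^ s) ^ 2 :=
            mul_le_mul (pow_le_pow_left₀ (norm_nonneg _) h1 2) (pow_le_pow_left₀ (norm_nonneg _) h2 2) (sq_nonneg _) (by positivity)
        _ = ((64 / 7) ^ s) ^ 2 * (∏ ν, 12 / omega n (k ν)) ^ 2 := by ring
  calc ∑ k : Fin d → Fin n, ‖rvec n s k p‖ ^ 2 ≤ ∑ k : Fin d → Fin n, ((64 / 7) ^ s) ^ 2 * ∏ ν, (12 / omega n (k ν)) ^ 2 :=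
        Finset.sum_le_sum fun k _ => hk k
    _ = ((64 / 7) ^ s) ^ 2 * ∑ k : Fin d → Fin n, ∏ ν, (12 / omega n (k ν)) ^ 2 := by rw [Finset.mul_sum]
    _ ≤ ((64 / 7) ^ s) ^ 2 * 576 ^ d := mul_le_mul_of_nonneg_left (sum_prod_sq_le n) (by positivity)
    _ = XB d s ^ 2 := by unfold XB; rw [mul_pow, ← pow_mul (24 : ℝ) d 2, mul_comm d 2, pow_mul]; norm_num

/-- [folklore] One coordinate of a vector is bounded by its `ℓ²` norm: `‖x k‖ ≤ √(sqNorm x)`. -/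
theorem norm_le_sqrt_sqNorm {ι : Type*} [Fintype ι] (x : ι → ℂ) (k : ι) : ‖x k‖ ≤ Real.sqrt (sqNorm x) := by
  rw [← Real.sqrt_sq (norm_nonneg (x k))]
  exact Real.sqrt_le_sqrt (Finset.single_le_sum (f := fun i => ‖x i‖ ^ 2) (fun i _ => sq_nonneg _) (Finset.mem_univ k))

/-- [folklore] The n-FREE fibre operator constant:
`Kop d s = (64∕7)^s + (132^d(64∕7)^s + (16d)^s·XB² + 2·12^d·XB)∕cB d`. -/
def Kop (d s : ℕ) : ℝ := (64 / 7) ^ s + (132 ^ d * (64 / 7) ^ s + (16 * (d : ℝ)) ^ s * XB d s ^ 2 + 2 * 12 ^ d * XB d s) / cB d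

/-- [folklore] `0 ≤ Kop`. -/
theorem Kop_nonneg (d s : ℕ) : 0 ≤ Kop d s := by
  unfold Kop; have := cB_pos d; have := XB_nonneg d s; positivity

/-- [folklore] Collapsing a double sum against a diagonal kernel. -/
theorem sum_sum_diag {ι : Type*} [Fintype ι] [DecidableEq ι] (x y D : ι → ℂ) (P : ι → Prop) [DecidablePred P] :
    ∑ k, ∑ k', x k * y k' * (if k = k' ∧ P k then D k else 0) = ∑ k, x k * y k * (if P k then D k else 0) := by
  refine Finset.sum_congr rfl fun k _ => ?_
  have : ∀ k', x k * y k' * (if k = k' ∧ P k then D k else 0) = if k = k' then x k * y k' * (if P k then D k else 0) else 0 :=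
    fun k' => by split_ifs <;> simp_all
  simp only [this, Finset.sum_ite_eq, Finset.mem_univ, if_true]

/-- [folklore] Collapsing a double sum against a single-entry kernel. -/
theorem sum_sum_single {ι : Type*} [Fintype ι] [DecidableEq ι] (x y : ι → ℂ) (a : ι) (c : ℂ) :
    ∑ k, ∑ k', x k * y k' * (if k = a ∧ k' = a then c else 0) = x a * y a * c := by
  have : ∀ k k' : ι, x k * y k' * (if k = a ∧ k' = a then c else 0) = if k' = a then (if k = a then x k * y k' * c else 0) else 0 :=
    fun k k' => by split_ifs <;> simp_all
  simp only [this, Finset.sum_ite_eq', Finset.mem_univ, if_true]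

/-- [folklore] Factorising a double sum against a rank-one kernel. -/
theorem sum_sum_rankOne {ι : Type*} [Fintype ι] (x y l r : ι → ℂ) (c : ℂ) :
    ∑ k, ∑ k', x k * y k' * (c * l k * r k') = c * (∑ k, x k * l k) * (∑ k', y k' * r k') := by
  rw [mul_assoc, Finset.sum_mul_sum, Finset.mul_sum]
  refine Finset.sum_congr rfl fun k _ => ?_
  rw [Finset.mul_sum]
  refine Finset.sum_congr rfl fun k' _ => ?_
  ring

variable (n s) in
/-- [folklore] The double sum against `T3` factorises into three rank-one products. -/
theorem sum_sum_T3 (x y : (Fin d → Fin n) → ℂ) (p : Fin d → ℂ) :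
    ∑ k, ∑ k', x k * y k' * T3 n s k k' p
      = -(DeltaXi n 0 p ^ s / den n s p) * (∑ k, x k * lvec n s k p) * (∑ k', y k' * rvec n s k' p)
        + -(den n s p)⁻¹ * (∑ k, x k * (if k = (fun _ => (0 : Fin n)) then F n (fun _ => 0) k p else 0)) * (∑ k', y k' * rvec n s k' p)
        + -(den n s p)⁻¹ * (∑ k, x k * lvec n s k p) * (∑ k', y k' * (if k' = (fun _ => (0 : Fin n)) then Fc n (fun _ => 0) k' p else 0)) := by
  rw [← sum_sum_rankOne, ← sum_sum_rankOne, ← sum_sum_rankOne, ← Finset.sum_add_distrib, ← Finset.sum_add_distrib]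
  refine Finset.sum_congr rfl fun k _ => ?_
  rw [← Finset.sum_add_distrib, ← Finset.sum_add_distrib]
  refine Finset.sum_congr rfl fun k' _ => ?_
  unfold T3
  ring

/-- [folklore] The single-entry sums `Σ_k x_k·[k=0]·u_k = x_0·u_0`. -/
theorem sum_mul_ite_zero (x : (Fin d → Fin n) → ℂ) (G : (Fin d → Fin n) → ℂ) :
    ∑ k : Fin d → Fin n, x k * (if k = (fun _ => (0 : Fin n)) then G k else 0) = x (fun _ => 0) * G (fun _ => 0) := by
  have : ∀ k : Fin d → Fin n, x k * (if k = (fun _ => (0 : Fin n)) then G k else 0) = if k = (fun _ => (0 : Fin n)) then x k * G k else 0 :=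
    fun k => by split_ifs <;> simp
  simp only [this, Finset.sum_ite_eq', Finset.mem_univ, if_true]

/-- [folklore] **THE FIBRE OPERATOR BOUND, n-FREE**: for every `n ≥ 1`, every `p′ ∈ Strip d (kappaB d s)` and all alias vectors `x, y`,
`‖Σ_{k,k′} x_k·y_{k′}·Gfib n s k k′ p′‖ ≤ Kop d s·√(sqNorm x)·√(sqNorm y)` — the diagonal piece by `(64∕7)^s`, the `(0,0)` entry by
`132^d(64∕7)^s∕cB`, the rank-one pieces by Cauchy–Schwarz with `sqNorm lvec, sqNorm rvec ≤ XB²`. -/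
theorem norm_sum_Gfib_le {p : Fin d → ℂ} (hp : p ∈ Strip d (kappaB d s)) (x y : (Fin d → Fin n) → ℂ) :
    ‖∑ k : Fin d → Fin n, ∑ k' : Fin d → Fin n, x k * y k' * Gfib n s k k' p‖
      ≤ Kop d s * (Real.sqrt (sqNorm x) * Real.sqrt (sqNorm y)) := by
  have hn1 : 1 ≤ n := Nat.one_le_iff_ne_zero.mpr (NeZero.ne n)
  have hfat : p ∈ Fat d (rOf d) := strip_subset_fat (rOf_pos d).le (kappaB_le_rOf d s) hp
  have hSX0 : 0 ≤ Real.sqrt (sqNorm x) := Real.sqrt_nonneg _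
  have hSY0 : 0 ≤ Real.sqrt (sqNorm y) := Real.sqrt_nonneg _
  have hcB := cB_pos d
  have hXB := XB_nonneg d s
  have hdi : ‖(den n s p)⁻¹‖ ≤ (cB d)⁻¹ := norm_inv_den_le_strip n s hp
  have hA0 : ‖DeltaXi n 0 p ^ s‖ ≤ (16 * (d : ℝ)) ^ s := by
    rw [norm_pow]
    have h := norm_DeltaXi_le n hn1 0 le_rfl (rOf_le d) hfat
    rw [add_zero] at h
    exact pow_le_pow_left₀ (norm_nonneg _) h s
  -- split the double sum along the pieces
  have hsplit : ∑ k : Fin d → Fin n, ∑ k' : Fin d → Fin n, x k * y k' * Gfib n s k k' p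
      = (∑ k : Fin d → Fin n, ∑ k' : Fin d → Fin n, x k * y k' * T1 n s k k' p)
        + (∑ k : Fin d → Fin n, ∑ k' : Fin d → Fin n, x k * y k' * T2 n s k k' p)
        + (∑ k : Fin d → Fin n, ∑ k' : Fin d → Fin n, x k * y k' * T3 n s k k' p) := by
    simp only [← Finset.sum_add_distrib]
    refine Finset.sum_congr rfl fun k _ => Finset.sum_congr rfl fun k' _ => ?_
    rw [Gfib_eq_pieces]; ring
  -- (1) diagonal
  have h1 : ‖∑ k : Fin d → Fin n, ∑ k' : Fin d → Fin n, x k * y k' * T1 n s k k' p‖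
      ≤ (64 / 7) ^ s * (Real.sqrt (sqNorm x) * Real.sqrt (sqNorm y)) := by
    unfold T1
    rw [sum_sum_diag]
    refine norm_sum_mul_mul_le x y _ (by positivity) fun k => ?_
    split_ifs with h
    · exact norm_ainv_le' n s (rOf_le d) (d_mul_rOf_sq_le d) hfat k h
    · rw [norm_zero]; positivity
  -- (2) the (0,0) entry
  have h2 : ‖∑ k : Fin d → Fin n, ∑ k' : Fin d → Fin n, x k * y k' * T2 n s k k' p‖
      ≤ 132 ^ d * (64 / 7) ^ s / cB d * (Real.sqrt (sqNorm x) * Real.sqrt (sqNorm y)) := by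
    unfold T2
    rw [sum_sum_single, norm_mul, norm_mul]
    have h00 := norm_Gfib_zero_zero_le n s hp
    unfold Gfib at h00
    rw [if_pos ⟨rfl, rfl⟩] at h00
    calc ‖x fun _ => 0‖ * ‖y fun _ => 0‖ * ‖Spr n s p / den n s p‖
        ≤ Real.sqrt (sqNorm x) * Real.sqrt (sqNorm y) * (132 ^ d * (64 / 7) ^ s / cB d) :=
          mul_le_mul (mul_le_mul (norm_le_sqrt_sqNorm x _) (norm_le_sqrt_sqNorm y _) (norm_nonneg _) hSX0) h00 (norm_nonneg _)
            (mul_nonneg hSX0 hSY0)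
      _ = 132 ^ d * (64 / 7) ^ s / cB d * (Real.sqrt (sqNorm x) * Real.sqrt (sqNorm y)) := by ring
  -- (3) the rank-one pieces
  have hl : Real.sqrt (sqNorm fun k => lvec n s k p) ≤ XB d s := by
    rw [← Real.sqrt_sq hXB]; exact Real.sqrt_le_sqrt (sqNorm_lvec_le (rOf_le d) (d_mul_rOf_sq_le d) hfat)
  have hrv : Real.sqrt (sqNorm fun k => rvec n s k p) ≤ XB d s := by
    rw [← Real.sqrt_sq hXB]; exact Real.sqrt_le_sqrt (sqNorm_rvec_le (rOf_le d) (d_mul_rOf_sq_le d) hfat)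
  have hxl : ‖∑ k : Fin d → Fin n, x k * lvec n s k p‖ ≤ Real.sqrt (sqNorm x) * XB d s :=
    (norm_sum_mul_le x _).trans (mul_le_mul_of_nonneg_left hl hSX0)
  have hyr : ‖∑ k' : Fin d → Fin n, y k' * rvec n s k' p‖ ≤ Real.sqrt (sqNorm y) * XB d s :=
    (norm_sum_mul_le y _).trans (mul_le_mul_of_nonneg_left hrv hSY0)
  have hF00 : ‖F n (fun _ => 0) (fun _ => (0 : Fin n)) p‖ ≤ 12 ^ d := by
    have h := norm_F_zero_le n (rOf_le d) (fun _ => (0 : Fin n)) hfat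
    simp only [Fin.val_zero, omega_zero n hn1, div_one, Finset.prod_const, Finset.card_univ, Fintype.card_fin] at h
    exact h
  have hFc00 : ‖Fc n (fun _ => 0) (fun _ => (0 : Fin n)) p‖ ≤ 12 ^ d := by
    have h := norm_Fc_zero_le n (rOf_le d) (fun _ => (0 : Fin n)) hfat
    simp only [Fin.val_zero, omega_zero n hn1, div_one, Finset.prod_const, Finset.card_univ, Fintype.card_fin] at h
    exact h
  have hx0 : ‖∑ k : Fin d → Fin n, x k * (if k = (fun _ => (0 : Fin n)) then F n (fun _ => 0) k p else 0)‖ ≤ Real.sqrt (sqNorm x) * 12 ^ d := by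
    rw [sum_mul_ite_zero, norm_mul]
    exact mul_le_mul (norm_le_sqrt_sqNorm x _) hF00 (norm_nonneg _) hSX0
  have hy0 : ‖∑ k' : Fin d → Fin n, y k' * (if k' = (fun _ => (0 : Fin n)) then Fc n (fun _ => 0) k' p else 0)‖ ≤ Real.sqrt (sqNorm y) * 12 ^ d := by
    rw [sum_mul_ite_zero, norm_mul]
    exact mul_le_mul (norm_le_sqrt_sqNorm y _) hFc00 (norm_nonneg _) hSY0
  have hA0den : ‖-(DeltaXi n 0 p ^ s / den n s p)‖ ≤ (16 * (d : ℝ)) ^ s * (cB d)⁻¹ := by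
    rw [norm_neg, norm_div, div_eq_mul_inv]
    rw [norm_inv] at hdi
    exact mul_le_mul hA0 hdi (inv_nonneg.mpr (norm_nonneg _)) (by positivity)
  have hdi' : ‖-(den n s p)⁻¹‖ ≤ (cB d)⁻¹ := by rw [norm_neg]; exact hdi
  have h3 : ‖∑ k : Fin d → Fin n, ∑ k' : Fin d → Fin n, x k * y k' * T3 n s k k' p‖
      ≤ ((16 * (d : ℝ)) ^ s * XB d s ^ 2 + 2 * 12 ^ d * XB d s) / cB d * (Real.sqrt (sqNorm x) * Real.sqrt (sqNorm y)) := by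
    rw [sum_sum_T3]
    have t1 : ‖-(DeltaXi n 0 p ^ s / den n s p) * (∑ k, x k * lvec n s k p) * (∑ k', y k' * rvec n s k' p)‖
        ≤ (16 * (d : ℝ)) ^ s * (cB d)⁻¹ * (Real.sqrt (sqNorm x) * XB d s) * (Real.sqrt (sqNorm y) * XB d s) := by
      rw [norm_mul, norm_mul]
      exact mul_le_mul (mul_le_mul hA0den hxl (norm_nonneg _) (by positivity)) hyr (norm_nonneg _) (by positivity)
    have t2 : ‖-(den n s p)⁻¹ * (∑ k, x k * (if k = (fun _ => (0 : Fin n)) then F n (fun _ => 0) k p else 0)) *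
          (∑ k', y k' * rvec n s k' p)‖ ≤ (cB d)⁻¹ * (Real.sqrt (sqNorm x) * 12 ^ d) * (Real.sqrt (sqNorm y) * XB d s) := by
      rw [norm_mul, norm_mul]
      exact mul_le_mul (mul_le_mul hdi' hx0 (norm_nonneg _) (by positivity)) hyr (norm_nonneg _) (by positivity)
    have t3 : ‖-(den n s p)⁻¹ * (∑ k, x k * lvec n s k p) *
          (∑ k', y k' * (if k' = (fun _ => (0 : Fin n)) then Fc n (fun _ => 0) k' p else 0))‖
        ≤ (cB d)⁻¹ * (Real.sqrt (sqNorm x) * XB d s) * (Real.sqrt (sqNorm y) * 12 ^ d) := by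
      rw [norm_mul, norm_mul]
      exact mul_le_mul (mul_le_mul hdi' hxl (norm_nonneg _) (by positivity)) hy0 (norm_nonneg _) (by positivity)
    refine (norm_add_le _ _).trans ((add_le_add ((norm_add_le _ _).trans (add_le_add t1 t2)) t3).trans (le_of_eq ?_))
    field_simp
    ring
  rw [hsplit]
  refine (norm_add_le _ _).trans ((add_le_add ((norm_add_le _ _).trans (add_le_add h1 h2)) h3).trans (le_of_eq ?_))
  unfold Kop
  ring

end Fibre

end Summit.QuantumFields.BalabanUV.Beta.FP.ConstrainedBiLaplacianFibreOperator

end
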